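import Literature.MathematicalPhysics.QuantumFieldTheory.Balaban1983to89.B9Thm31SiteGpBoundsReg335Y
import Literature.MathematicalPhysics.QuantumFieldTheory.Balaban1983to89.B9Thm311LocalInversePosY

/-!
# `Balaban1983to89.B9Thm31SiteGsqBoundsReg335Y` — T. Bałaban, *Propagators for lattice gauge theories in a background field*, Commun. Math. Phys.
# **99** (1985) 389–434 [Balaban1985BackgroundPropagators] Thm 3.1 p. 397 ∕ (3.25) p. 394 ∕ (3.79) p. 406 ∕ Cor 3.6 p. 408, with [4] = [Balaban1984PropagatorsII] p. 225:
# ★ **THE □̃-COMPRESSED `Δ′_a(U)` IS UNIFORMLY COERCIVE ON THE (3.35) CLASS — THEOREM 3.1 ∕ COROLLARY 3.6 AT THE `L²` LEVEL FOR THE GENUINE LOCAL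
# CUBE INVERSES `G′_□(U) = GsqY i (parSymY i) D U` OF (3.79), UNIFORMLY IN □** (file 19 of the site-sector set of width seat `pub-ymgap-dag-n06-w1`;
# file 4 = `B9Thm31SiteGpBoundsReg335Y` is the `D = univ` face; the regime-free positivity ∕ invertibility layer is dag-n06-j's `B9Thm311LocalInversePosY`)

statement-level skeleton of published theorems with citation tags; proofs where landed; nothing here is a claim about the Yang–Mills mass gap

THE PRINT (verbatim).  p. 406, (3.79): *«`G′_□` denotes a propagator defined by (3.24), (3.25) for the sequence `{Ω_n(□)}`»* — i.e. the inverse of `Δ′_a(U)`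
restricted to the functions on □̃ (Dirichlet data); p. 408, Cor 3.6: *«the operators `G′_□`, `G_□` … satisfy the inequalities (3.42)–(3.47) with constants
independent of □»*; p. 394–395, (3.25): *«Assuming some regularity of the configuration U it can be easily shown that the operator Δ′_a is positive. This
implies positivity of the operators G′ …»*; [4] p. 225: *«The operator G′ = Δ′_a^{−1} is a well defined, positive operator»*.

WHY THIS FILE (cell `pub-ymgap`, Track A node N06 [B9], width seat `pub-ymgap-dag-n06-w1`, gen 3).  node00-def-Y's FILE 35 `Node00.OpsYLocalInverse` (p605048)
constructs the genuine local cube inverses of (3.79) at def-Y's letters as `GsqY i par D U := P_D (padΔ_D(U))⁻¹ P_D` with the PADDED COMPRESSION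
`padDeltaY i par D U := P_D Δ′_a(U) P_D + (1 − P_D)` (`P_D = cubeProjY i D` the restriction to the functions supported in `D = □̃`), every inverse identity
((3.87)–(3.88), (3.90)) being stated under the hypothesis `IsUnit (padDeltaY i par D U)`; the N06 knit owner (dag-n06-d, ANSWER-W-a (a1)) asked whether that
invertibility is a displayed binder or a theorem.  The REGIME-FREE half of the answer (positive definiteness, hence invertibility, of `padDeltaY i (parSymY i) D U`
at every `G`-valued `U`) is dag-n06-j's `B9Thm311LocalInversePosY` (p606285, `isUnit_padDeltaY_parSymY`), imported and cited BY NAME here (bus DEDUP-SPLIT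
2026-08-28T04:50Z).  THIS FILE is the QUANTITATIVE half: ON THE CLASS (3.35) the level-weighted and the uniform `(1∕8)·(L^k)⁻²` coercivity of file 3c restrict to
every Dirichlet compression (`trIP_padDeltaY_parSymY_ge_levelMass`, `trIP_padDeltaY_parSymY_ge`), so file 4's two-sided `L²` bounds hold VERBATIM for `G′_□(U)`:
`‖G′_□(U)Ψ‖² ≤ (8L^{2k})²‖Ψ‖²`, `⟨Ψ, G′_□(U)Ψ⟩ ≤ 8L^{2k}‖Ψ‖²`, `(1∕8)L^{−2k}‖G′_□Ψ‖² ≤ ⟨Ψ, G′_□Ψ⟩` (and level-weighted), and — no smallness — symmetry and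
`‖P_DΨ‖² ≤ (4(d+1)+1)·⟨Ψ, G′_□(U)Ψ⟩`: the `L²` shadow of Cor 3.6's «constants independent of □» (member-, volume-, `k`-, `N`-, `U`- AND `D`-uniform).

WHAT IS PROVED (sorry-free; 0 `def`; no inequality of [B9] asserted as a hypothesis-free fact beyond what is proved).
* §1 the cube projection inside the trace pairing: `hs_cubeProjY_apply` (`HS((P_DΦ) z) = 𝟙_D(z)·HS(Φ z)`), `trIP_cubeProjY_self_eq`, `trIP_cubeProjY_self_le`
  (`‖P_DΦ‖²₁ ≤ ‖Φ‖²₁`), `trIP_self_sub_cubeProjY_eq` (`‖Φ‖²₁ − ‖P_DΦ‖²₁ = Σ_{z∉D} HS(Φ z)`); the symmetry `⟨Φ, P_DΨ⟩_w = ⟨P_DΦ, Ψ⟩_w` is dag-n06-j's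
  `trIP_cubeProjY_symm ∕ _left ∕ _right`, cited.
* §2 the padded compression as a form (any transporter letter `par`): `padDeltaY_apply`, ★ `trIP_padDeltaY_right` (BILINEAR: `⟨Ψ, padΔ_D(U)Φ⟩_w =
  ⟨P_DΨ, Δ′_a(U)P_DΦ⟩_w + (⟨Ψ, Φ⟩_w − ⟨P_DΨ, P_DΦ⟩_w)`), `trIP_padDeltaY_eq`, `trIP_padDeltaY_eq'` (diagonal, complementary mass as a site sum); `GsqY_apply`,
  `trIP_GsqY_right` (BILINEAR: `⟨Φ, G′_□Ψ⟩_w = ⟨P_DΦ, padΔ_D⁻¹P_DΨ⟩_w`; the diagonal is dag-n06-j's `trIP_GsqY_eq`).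
* §3 REGIME-FREE, at every `G`-valued `U`, `G ≤ U(N)`, every `D` (on dag-n06-j's `padDeltaY_parSymY_posDefTr ∕ isUnit_padDeltaY_parSymY`): ★ `isSymmTr_padDeltaY_parSymY`,
  `trIP_padDeltaY_parSymY_le` (`≤ (4(d+1)+1)‖Φ‖²`), `isSymmTr_GsqY_parSymY`, ★★ `trIP_cubeProjY_self_le_GsqY_parSymY` (`‖P_DΨ‖² ≤ (4(d+1)+1)⟨Ψ, G′_□(U)Ψ⟩`).
* §4 ON THE CLASS `(bg9K (M_N ℂ) G i).Reg335 c α₀`, `N ≥ 1`, `0 ≤ c·M·α₀`, `c·M·α₀·(d+1) ≤ 1∕16`, every `D`: ★★ `trIP_padDeltaY_parSymY_ge_levelMass`,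
  ★★★ `trIP_padDeltaY_parSymY_ge` (`(1∕8)(L^k)⁻²‖Φ‖² ≤ ⟨Φ, padΔ_D(U)Φ⟩`), ★★★ `trIP_GsqY_parSymY_self_le` (`‖G′_□(U)Ψ‖² ≤ (8(L^k)²)²‖Ψ‖²`),
  ★★ `trIP_GsqY_parSymY_le`, ★★ `trIP_GsqY_parSymY_ge_self`, ★ `levelMass_GsqY_parSymY_le`.
MODEL ∕ DECLARED READINGS.  (M1)–(M4) as file 4 (def-Y's letters on NODE 00's box chart, fibre `M_N(ℂ)`, weight-`1` trace pairing, masses in lattice units,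
«operator norm» = form inequalities).  (M5) □̃ is an ARBITRARY finite site set `D` (the walk's `cubeDomY x c` of dag-n06-d's FILE C is one instance); the
Dirichlet restriction is def-Y's `cubeProjY`∕`padDeltaY`∕`GsqY` BY NAME — nothing of FILE 35 is restated.  NOT HERE: the decay half of Cor 3.6 ((3.42)–(3.47)
for `G′_□`), the bond sector `G_□`, the sup-norm currency.  NON-VACUITY (A6): `U ≡ 1 ∈ Reg335 c α₀` (`B9BackgroundsKLevelV1.reg335_one`) as in files 3c∕4;
§3 holds at every unitary-valued background and every `D` (e.g. `D = univ`: `padDeltaY_univ`, `GsqY_univ` recover file 4).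
HONEST SCOPE.  Finite-dimensional consequences of two landed form facts (file 3c's coercivity, dag-n06-j's positivity), constants explicit; NOT a node
discharge, NOT summit progress; count-neutral; nothing continuum ∕ OS ∕ mass gap ∕ Clay.  NEW file importing file 4 and dag-n06-j's `B9Thm311LocalInversePosY`
(hence def-Y's FILE 35) only; nothing landed is modified.  Net new unproved facts: 0.
-/

noncomputable section

namespace Literature.MathematicalPhysics.QuantumFieldTheory.Balaban1983to89.B9Thm31SiteGsqBoundsReg335Y

open Literature.MathematicalPhysics.QuantumFieldTheory.Balaban1983to89
open Node00 B6KLevelCensusIndexV1 B6Geom246MultiLevelBox B6MultiLevelBoxOperator B6MultiLevelTorusOperator B6GlobalChartV1 B9BackgroundsKLevelV1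
  B9Eq39Adjoint B9Thm311ReadingCoords B9Thm311DeltaPrimePos B9Ineq369CurvatureSmallAtLettersY B9Thm31SiteCoerciveReg335Y B9Thm31SiteGpBoundsReg335Y
  Node00.OpsYLocalInverse B9Thm311LocalInversePosY
open Literature.MathematicalPhysics.QuantumFieldTheory.Balaban1983to89.B9Ineq349SiteAdjoint (trIP_comm isSymmTr_ringInverse)
open Literature.MathematicalPhysics.QuantumFieldTheory.Balaban1983to89.B9Eq3132CoerciveVariational (trIP_sub_right trIP_smul_right)
open Literature.MathematicalPhysics.QuantumFieldTheory.Balaban1983to89.B9Thm311SymmAtRecordV4 (symm0_parSymY)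
open scoped Matrix Matrix.Norms.L2Operator

variable {d ℓ : ℕ} {hd : 1 ≤ d + 1} {hL : Odd (ℓ + 1) ∧ 1 < ℓ + 1} {b₀ b₁ : ℝ}
variable (i : KIdx d ℓ hd hL b₀ b₁) {N : ℕ} {G : Subgroup (Matrix (Fin N) (Fin N) ℂ)ˣ}

/-! ## §1 The cube projection `P_D = M_{𝟙_D}` inside the trace pairing -/

section Projection

/-- the fibre Hilbert–Schmidt sum of the projected field: `HS((P_DΦ) z) = 𝟙_D(z)·HS(Φ z)`. [cite: Balaban1985BackgroundPropagators, (3.79) p.406 (□̃), bookkeeping] -/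
theorem hs_cubeProjY_apply (D : Finset (SiteY i)) (Φ : SiteY i → Matrix (Fin N) (Fin N) ℂ) (z : SiteY i) :
    ∑ a, ∑ b, ‖cubeProjY i D Φ z a b‖ ^ 2 = if z ∈ D then ∑ a, ∑ b, ‖Φ z a b‖ ^ 2 else 0 := by
  rw [cubeProjY_apply]
  split_ifs
  · rfl
  · simp

/-- the weight-`1` norm of the projected field: `‖P_DΦ‖²₁ = Σ_z 𝟙_D(z)·HS(Φ z)`. [cite: Balaban1985BackgroundPropagators, p.393 (scalar products), bookkeeping] -/
theorem trIP_cubeProjY_self_eq (D : Finset (SiteY i)) (Φ : SiteY i → Matrix (Fin N) (Fin N) ℂ) :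
    trIP (fun _ => (1 : ℝ)) (cubeProjY i D Φ) (cubeProjY i D Φ) = ∑ z, if z ∈ D then ∑ a, ∑ b, ‖Φ z a b‖ ^ 2 else 0 := by
  rw [trIP_one_self_eq]
  exact Finset.sum_congr rfl fun z _ => hs_cubeProjY_apply i D Φ z

/-- the projection is a contraction: `‖P_DΦ‖²₁ ≤ ‖Φ‖²₁`. [cite: Balaban1985BackgroundPropagators, (3.79) p.406, bookkeeping] -/
theorem trIP_cubeProjY_self_le (D : Finset (SiteY i)) (Φ : SiteY i → Matrix (Fin N) (Fin N) ℂ) :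
    trIP (fun _ => (1 : ℝ)) (cubeProjY i D Φ) (cubeProjY i D Φ) ≤ trIP (fun _ => (1 : ℝ)) Φ Φ := by
  rw [trIP_cubeProjY_self_eq, trIP_one_self_eq]
  refine Finset.sum_le_sum fun z _ => ?_
  split_ifs
  · exact le_rfl
  · exact hs_nonneg _

/-- the complementary mass: `‖Φ‖²₁ − ‖P_DΦ‖²₁ = Σ_{z∉D} HS(Φ z)`. [cite: Balaban1985BackgroundPropagators, (3.79) p.406, bookkeeping] -/
theorem trIP_self_sub_cubeProjY_eq (D : Finset (SiteY i)) (Φ : SiteY i → Matrix (Fin N) (Fin N) ℂ) :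
    trIP (fun _ => (1 : ℝ)) Φ Φ - trIP (fun _ => (1 : ℝ)) (cubeProjY i D Φ) (cubeProjY i D Φ)
      = ∑ z, if z ∈ D then 0 else ∑ a, ∑ b, ‖Φ z a b‖ ^ 2 := by
  rw [trIP_cubeProjY_self_eq, trIP_one_self_eq, ← Finset.sum_sub_distrib]
  refine Finset.sum_congr rfl fun z _ => ?_
  split_ifs <;> simp

end Projection

/-! ## §2 The padded compression `padΔ_D(U) = P_D Δ′_a(U) P_D + (1 − P_D)` as a form; `G′_□(U)` inside the pairing -/

section Form

/-- the padded compression, applied: `padΔ_D(U)Φ = P_D(Δ′_a(U)(P_DΦ)) + (Φ − P_DΦ)`. [cite: Balaban1985BackgroundPropagators, (3.79) p.406, bookkeeping] -/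
theorem padDeltaY_apply (par : SiteParY (Matrix (Fin N) (Fin N) ℂ) i) (D : Finset (SiteY i)) (U : CfgY (Matrix (Fin N) (Fin N) ℂ) i)
    (Φ : SiteY i → Matrix (Fin N) (Fin N) ℂ) :
    padDeltaY i par D U Φ = cubeProjY i D (deltaPrimeAY i par U (cubeProjY i D Φ)) + (Φ - cubeProjY i D Φ) := by
  simp only [padDeltaY, dirPadY, LinearMap.add_apply, LinearMap.sub_apply, Module.End.mul_apply, Module.End.one_apply]

/-- ★ **THE PADDED COMPRESSION AS A BILINEAR FORM**: `⟨Ψ, padΔ_D(U)Φ⟩_w = ⟨P_DΨ, Δ′_a(U)P_DΦ⟩_w + (⟨Ψ, Φ⟩_w − ⟨P_DΨ, P_DΦ⟩_w)` — the compressed form on □̃ plus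
the identity form off □̃. [cite: Balaban1985BackgroundPropagators, (3.79) p.406, (3.24) p.394] -/
theorem trIP_padDeltaY_right (w : SiteY i → ℝ) (par : SiteParY (Matrix (Fin N) (Fin N) ℂ) i) (D : Finset (SiteY i))
    (U : CfgY (Matrix (Fin N) (Fin N) ℂ) i) (Φ Ψ : SiteY i → Matrix (Fin N) (Fin N) ℂ) :
    trIP w Ψ (padDeltaY i par D U Φ)
      = trIP w (cubeProjY i D Ψ) (deltaPrimeAY i par U (cubeProjY i D Φ)) + (trIP w Ψ Φ - trIP w (cubeProjY i D Ψ) (cubeProjY i D Φ)) := by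
  rw [padDeltaY_apply, trIP_add_right, trIP_sub_right, trIP_cubeProjY_symm i w D Ψ (deltaPrimeAY i par U (cubeProjY i D Φ)),
    trIP_cubeProjY_symm i w D Ψ Φ, trIP_cubeProjY_left i w D Ψ Φ]

/-- ★ **FORM SPLITTING** (diagonal): `⟨Φ, padΔ_D(U)Φ⟩₁ = ⟨P_DΦ, Δ′_a(U)P_DΦ⟩₁ + (‖Φ‖²₁ − ‖P_DΦ‖²₁)`. [cite: Balaban1985BackgroundPropagators, (3.79) p.406, (3.24) p.394] -/
theorem trIP_padDeltaY_eq (par : SiteParY (Matrix (Fin N) (Fin N) ℂ) i) (D : Finset (SiteY i)) (U : CfgY (Matrix (Fin N) (Fin N) ℂ) i)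
    (Φ : SiteY i → Matrix (Fin N) (Fin N) ℂ) :
    trIP (fun _ => (1 : ℝ)) Φ (padDeltaY i par D U Φ)
      = trIP (fun _ => (1 : ℝ)) (cubeProjY i D Φ) (deltaPrimeAY i par U (cubeProjY i D Φ))
        + (trIP (fun _ => (1 : ℝ)) Φ Φ - trIP (fun _ => (1 : ℝ)) (cubeProjY i D Φ) (cubeProjY i D Φ)) :=
  trIP_padDeltaY_right i _ par D U Φ Φ

/-- form splitting with the complementary mass written out: `⟨Φ, padΔ_D(U)Φ⟩₁ = ⟨P_DΦ, Δ′_a(U)P_DΦ⟩₁ + Σ_{z∉D} HS(Φ z)`.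
[cite: Balaban1985BackgroundPropagators, (3.79) p.406, (3.24) p.394] -/
theorem trIP_padDeltaY_eq' (par : SiteParY (Matrix (Fin N) (Fin N) ℂ) i) (D : Finset (SiteY i)) (U : CfgY (Matrix (Fin N) (Fin N) ℂ) i)
    (Φ : SiteY i → Matrix (Fin N) (Fin N) ℂ) :
    trIP (fun _ => (1 : ℝ)) Φ (padDeltaY i par D U Φ)
      = trIP (fun _ => (1 : ℝ)) (cubeProjY i D Φ) (deltaPrimeAY i par U (cubeProjY i D Φ)) + ∑ z, if z ∈ D then 0 else ∑ a, ∑ b, ‖Φ z a b‖ ^ 2 := by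
  rw [trIP_padDeltaY_eq, trIP_self_sub_cubeProjY_eq]

/-- `G′_□(U)`, applied: `G′_□(U)Ψ = P_D((padΔ_D(U))⁻¹(P_DΨ))`. [cite: Balaban1985BackgroundPropagators, (3.79) p.406, bookkeeping] -/
theorem GsqY_apply (par : SiteParY (Matrix (Fin N) (Fin N) ℂ) i) (D : Finset (SiteY i)) (U : CfgY (Matrix (Fin N) (Fin N) ℂ) i)
    (Ψ : SiteY i → Matrix (Fin N) (Fin N) ℂ) :
    GsqY i par D U Ψ = cubeProjY i D (Ring.inverse (padDeltaY i par D U) (cubeProjY i D Ψ)) := by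
  rw [GsqY_def, Module.End.mul_apply, Module.End.mul_apply]

/-- `G′_□(U)` inside the pairing: `⟨Φ, G′_□(U)Ψ⟩_w = ⟨P_DΦ, (padΔ_D(U))⁻¹P_DΨ⟩_w`. [cite: Balaban1985BackgroundPropagators, (3.79) p.406, bookkeeping] -/
theorem trIP_GsqY_right (w : SiteY i → ℝ) (par : SiteParY (Matrix (Fin N) (Fin N) ℂ) i) (D : Finset (SiteY i)) (U : CfgY (Matrix (Fin N) (Fin N) ℂ) i)
    (Φ Ψ : SiteY i → Matrix (Fin N) (Fin N) ℂ) :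
    trIP w Φ (GsqY i par D U Ψ) = trIP w (cubeProjY i D Φ) (Ring.inverse (padDeltaY i par D U) (cubeProjY i D Ψ)) := by
  rw [GsqY_apply, trIP_cubeProjY_symm]

end Form

/-! ## §3 Regime-free consequences at every `G`-valued background (positivity ∕ invertibility: dag-n06-j's `B9Thm311LocalInversePosY`) -/

section RegimeFree

/-- ★ **`padΔ_D(U)` IS SYMMETRIC** for the weight-`1` trace pairing at every `G`-valued `U`, `G ≤ U(N)`, every `D`. [cite: Balaban1985BackgroundPropagators, (3.24) p.394, Thm 3.11 p.416 («symmetric»), (3.79) p.406] -/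
theorem isSymmTr_padDeltaY_parSymY (hG : G ≤ B7Prop2Explicit.unitaryUnits (Matrix (Fin N) (Fin N) ℂ)) {U : CfgY (Matrix (Fin N) (Fin N) ℂ) i}
    (hU : ∀ μ x, U μ x ∈ G) (D : Finset (SiteY i)) : IsSymmTr (fun _ => (1 : ℝ)) (padDeltaY i (parSymY i) D U) := by
  intro Φ Ψ
  rw [trIP_comm _ _ Ψ, trIP_padDeltaY_right, trIP_padDeltaY_right,
    trIP_comm _ (cubeProjY i D Ψ) (deltaPrimeAY i (parSymY i) U (cubeProjY i D Φ)),
    symm0_parSymY i hG hU (cubeProjY i D Φ) (cubeProjY i D Ψ), trIP_comm _ Ψ Φ, trIP_comm _ (cubeProjY i D Ψ) (cubeProjY i D Φ)]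

/-- **THE UPPER FORM BOUND — NO smallness**: `⟨Φ, padΔ_D(U)Φ⟩₁ ≤ (4(d+1)+1)·‖Φ‖²₁` at every `G`-valued `U`, `G ≤ U(N)`, every `D` (file 4's (3.24) bound on □̃,
the identity off □̃). [cite: Balaban1985BackgroundPropagators, (3.24) pp.394–395, Thm 3.11 p.416, (3.79) p.406] -/
theorem trIP_padDeltaY_parSymY_le (hG : G ≤ B7Prop2Explicit.unitaryUnits (Matrix (Fin N) (Fin N) ℂ)) {U : CfgY (Matrix (Fin N) (Fin N) ℂ) i}
    (hU : ∀ μ x, U μ x ∈ G) (D : Finset (SiteY i)) (Φ : SiteY i → Matrix (Fin N) (Fin N) ℂ) :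
    trIP (fun _ => (1 : ℝ)) Φ (padDeltaY i (parSymY i) D U Φ) ≤ (4 * ((d : ℝ) + 1) + 1) * trIP (fun _ => (1 : ℝ)) Φ Φ := by
  rw [trIP_padDeltaY_eq]
  have h1 := trIP_deltaPrimeAY_parSymY_le i hG hU (cubeProjY i D Φ)
  have h2 := trIP_cubeProjY_self_le i D Φ
  have h3 : 0 ≤ trIP (fun _ => (1 : ℝ)) (cubeProjY i D Φ) (cubeProjY i D Φ) := trIP_self_nonneg _ (fun _ => one_pos) _
  have hd : (0 : ℝ) ≤ 4 * ((d : ℝ) + 1) := by positivity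
  have h4 := mul_le_mul_of_nonneg_left h2 hd
  nlinarith

/-- `G′_□(U)` is symmetric (regime-free; the local inverse of a symmetric operator, sandwiched by the symmetric projection).
[cite: Balaban1985BackgroundPropagators, Thm 3.11 p.416 («symmetric»), (3.79) p.406] -/
theorem isSymmTr_GsqY_parSymY (hG : G ≤ B7Prop2Explicit.unitaryUnits (Matrix (Fin N) (Fin N) ℂ)) {U : CfgY (Matrix (Fin N) (Fin N) ℂ) i}
    (hU : ∀ μ x, U μ x ∈ G) (D : Finset (SiteY i)) : IsSymmTr (fun _ => (1 : ℝ)) (GsqY i (parSymY i) D U) := by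
  intro Φ Ψ
  rw [trIP_comm _ _ Ψ, trIP_GsqY_right, trIP_GsqY_right,
    trIP_comm _ (cubeProjY i D Ψ) (Ring.inverse (padDeltaY i (parSymY i) D U) (cubeProjY i D Φ)),
    isSymmTr_ringInverse _ (isSymmTr_padDeltaY_parSymY i hG hU D) (cubeProjY i D Φ) (cubeProjY i D Ψ)]

/-- ★★ **«G′_□(U) ≥ (4(d+1)+1)⁻¹ ON □̃» AT EVERY `G`-VALUED BACKGROUND**, `G ≤ U(N)` (no smallness): `‖P_DΨ‖²₁ ≤ (4(d+1)+1)·⟨Ψ, G′_□(U)Ψ⟩₁` — the upper bound of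
(3.24) transported to the symmetric positive local inverse; constants free of □. [cite: Balaban1985BackgroundPropagators, Thm 3.11 p.416, (3.24)–(3.25) pp.394–395, Cor 3.6 p.408 («constants independent of □»)] -/
theorem trIP_cubeProjY_self_le_GsqY_parSymY (hG : G ≤ B7Prop2Explicit.unitaryUnits (Matrix (Fin N) (Fin N) ℂ)) {U : CfgY (Matrix (Fin N) (Fin N) ℂ) i}
    (hU : ∀ μ x, U μ x ∈ G) (D : Finset (SiteY i)) (Ψ : SiteY i → Matrix (Fin N) (Fin N) ℂ) :
    trIP (fun _ => (1 : ℝ)) (cubeProjY i D Ψ) (cubeProjY i D Ψ) ≤ (4 * ((d : ℝ) + 1) + 1) * trIP (fun _ => (1 : ℝ)) Ψ (GsqY i (parSymY i) D U Ψ) := by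
  have hpd := padDeltaY_parSymY_posDefTr i hG hU D
  have hpos : ∀ Φ, 0 ≤ trIP (fun _ => (1 : ℝ)) Φ (padDeltaY i (parSymY i) D U Φ) := by
    intro Φ
    by_cases hΦ : Φ = 0
    · rw [hΦ, map_zero, trIP_zero_right]
    · exact (hpd Φ hΦ).le
  have hd1 : (0 : ℝ) < 4 * ((d : ℝ) + 1) + 1 := by positivity
  rw [trIP_GsqY_right i _ (parSymY i) D U Ψ Ψ]
  exact trIP_self_le_ringInverse_of_symm (isSymmTr_padDeltaY_parSymY i hG hU D) hpos hd1 (trIP_padDeltaY_parSymY_le i hG hU D)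
    (isUnit_padDeltaY_parSymY i hG hU D) (cubeProjY i D Ψ)

end RegimeFree

/-! ## §4 On the class (3.35): uniform coercivity of the compressions and the two-sided bounds of `G′_□(U)` -/

section Main

/-- ★★ **THE LEVEL-WEIGHTED COERCIVITY RESTRICTS TO EVERY DIRICHLET COMPRESSION**: for `G ≤ U(N)`, `N ≥ 1`, `0 ≤ c·M·α₀`, `c·M·α₀·(d+1) ≤ 1∕16`, every
`U ∈ (bg9K (M_N ℂ) G i).Reg335 c α₀`, every `D` and every `Φ`:  `(1∕8)·Σ_z (L^{lev z})⁻²·HS(Φ z) ≤ ⟨Φ, padΔ_D(U)Φ⟩₁` (file 3c on the □̃-part, `(1∕8)(L^{lev})⁻² ≤ 1`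
on the identity part). [cite: Balaban1985BackgroundPropagators, Thm 3.1 p.397, Cor 3.6 p.408, (3.24) p.394, (3.79) p.406; Balaban1984PropagatorsII, (2.14) p.225] -/
theorem trIP_padDeltaY_parSymY_ge_levelMass [Nonempty (Fin N)] (hG : G ≤ B7Prop2Explicit.unitaryUnits (Matrix (Fin N) (Fin N) ℂ))
    {U : CfgY (Matrix (Fin N) (Fin N) ℂ) i} {c α₀ : ℝ} (hC0 : 0 ≤ c * (kGeo i).M * α₀) (hC1 : c * (kGeo i).M * α₀ * ((d : ℝ) + 1) ≤ 1 / 16)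
    (hreg : (bg9K (Matrix (Fin N) (Fin N) ℂ) G i).Reg335 c α₀ U) (D : Finset (SiteY i)) (Φ : SiteY i → Matrix (Fin N) (Fin N) ℂ) :
    (1 / 8 : ℝ) * ∑ z : SiteY i, (((((ℓ + 1) ^ (blkOf i.D.toDomains z).1.1 : ℕ) : ℝ)) ^ 2)⁻¹ * ∑ a, ∑ b, ‖Φ z a b‖ ^ 2
      ≤ trIP (fun _ => (1 : ℝ)) Φ (padDeltaY i (parSymY i) D U Φ) := by
  rw [trIP_padDeltaY_eq']
  have h1 := trIP_deltaPrimeAY_parSymY_ge_levelMass i hG hC0 hC1 hreg (cubeProjY i D Φ)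
  refine le_trans ?_ (add_le_add h1 le_rfl)
  rw [Finset.mul_sum, Finset.mul_sum, ← Finset.sum_add_distrib]
  refine Finset.sum_le_sum fun z _ => ?_
  rw [hs_cubeProjY_apply]
  split_ifs with hz
  · exact le_add_of_nonneg_right le_rfl
  · rw [mul_zero, mul_zero, zero_add]
    have h0 : 0 ≤ ∑ a, ∑ b, ‖Φ z a b‖ ^ 2 := hs_nonneg _
    have hn1 : (1 : ℝ) ≤ (((ℓ + 1) ^ (blkOf i.D.toDomains z).1.1 : ℕ) : ℝ) := by
      exact_mod_cast Nat.one_le_pow _ _ (Nat.succ_pos ℓ)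
    have hc1 : (((((ℓ + 1) ^ (blkOf i.D.toDomains z).1.1 : ℕ) : ℝ)) ^ 2)⁻¹ ≤ 1 := inv_le_one_of_one_le₀ (one_le_pow₀ hn1)
    have hc0 : 0 ≤ (((((ℓ + 1) ^ (blkOf i.D.toDomains z).1.1 : ℕ) : ℝ)) ^ 2)⁻¹ := inv_nonneg.2 (by positivity)
    nlinarith

/-- ★★★ **THE UNIFORM `(1∕8)·L^{−2k}` COERCIVITY OF EVERY DIRICHLET COMPRESSION ON THE CLASS**: `(1∕8)·(L^k)⁻²·‖Φ‖²₁ ≤ ⟨Φ, padΔ_D(U)Φ⟩₁` — so the local cube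
inverse `G′_□(U)` has `L²`-operator norm `≤ 8L^{2k}` UNIFORMLY over the class, the member, `N` AND □. [cite: Balaban1985BackgroundPropagators, Thm 3.1 p.397, Cor 3.6 p.408 («constants independent of □»), (3.79) p.406; Balaban1984PropagatorsII, p.225] -/
theorem trIP_padDeltaY_parSymY_ge [Nonempty (Fin N)] (hG : G ≤ B7Prop2Explicit.unitaryUnits (Matrix (Fin N) (Fin N) ℂ))
    {U : CfgY (Matrix (Fin N) (Fin N) ℂ) i} {c α₀ : ℝ} (hC0 : 0 ≤ c * (kGeo i).M * α₀) (hC1 : c * (kGeo i).M * α₀ * ((d : ℝ) + 1) ≤ 1 / 16)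
    (hreg : (bg9K (Matrix (Fin N) (Fin N) ℂ) G i).Reg335 c α₀ U) (D : Finset (SiteY i)) (Φ : SiteY i → Matrix (Fin N) (Fin N) ℂ) :
    (1 / 8 : ℝ) * (((((ℓ + 1) ^ i.k : ℕ) : ℝ)) ^ 2)⁻¹ * trIP (fun _ => (1 : ℝ)) Φ Φ ≤ trIP (fun _ => (1 : ℝ)) Φ (padDeltaY i (parSymY i) D U Φ) := by
  refine le_trans ?_ (trIP_padDeltaY_parSymY_ge_levelMass i hG hC0 hC1 hreg D Φ)
  rw [trIP_one_self_eq, Finset.mul_sum, Finset.mul_sum]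
  refine Finset.sum_le_sum fun z _ => ?_
  have hz0 : 0 ≤ ∑ a, ∑ b, ‖Φ z a b‖ ^ 2 := hs_nonneg _
  have hjk : (blkOf i.D.toDomains z).1.1 ≤ i.k := (scale_bounds i.D.toDomains _).2
  have hpow : (((ℓ + 1) ^ (blkOf i.D.toDomains z).1.1 : ℕ) : ℝ) ≤ (((ℓ + 1) ^ i.k : ℕ) : ℝ) := by
    exact_mod_cast Nat.pow_le_pow_right (Nat.succ_pos ℓ) hjk
  have hpos : (0 : ℝ) < (((ℓ + 1) ^ (blkOf i.D.toDomains z).1.1 : ℕ) : ℝ) := by positivity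
  have hinv : (((((ℓ + 1) ^ i.k : ℕ) : ℝ)) ^ 2)⁻¹ ≤ (((((ℓ + 1) ^ (blkOf i.D.toDomains z).1.1 : ℕ) : ℝ)) ^ 2)⁻¹ := by
    apply inv_anti₀ (by positivity)
    exact pow_le_pow_left₀ hpos.le hpow 2
  rw [mul_assoc]
  exact mul_le_mul_of_nonneg_left (mul_le_mul_of_nonneg_right hinv hz0) (by norm_num)

/-- ★★★ **«‖G′_□(U)‖ ≤ 8L^{2k}» UNIFORMLY ON THE CLASS AND IN □**: `‖G′_□(U)Ψ‖²₁ ≤ (8·(L^k)²)²·‖Ψ‖²₁` for every `Ψ` and every site set `D` — def-Y's genuine local cube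
inverse `GsqY i (parSymY i) D U` of (3.79); constants free of the member, the volume, `k`, `N`, `U` and □.
[cite: Balaban1985BackgroundPropagators, Thm 3.1 p.397, Cor 3.6 p.408, (3.79) p.406; Balaban1984PropagatorsII, p.225] -/
theorem trIP_GsqY_parSymY_self_le [Nonempty (Fin N)] (hG : G ≤ B7Prop2Explicit.unitaryUnits (Matrix (Fin N) (Fin N) ℂ))
    {U : CfgY (Matrix (Fin N) (Fin N) ℂ) i} {c α₀ : ℝ} (hC0 : 0 ≤ c * (kGeo i).M * α₀) (hC1 : c * (kGeo i).M * α₀ * ((d : ℝ) + 1) ≤ 1 / 16)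
    (hreg : (bg9K (Matrix (Fin N) (Fin N) ℂ) G i).Reg335 c α₀ U) (D : Finset (SiteY i)) (Ψ : SiteY i → Matrix (Fin N) (Fin N) ℂ) :
    trIP (fun _ => (1 : ℝ)) (GsqY i (parSymY i) D U Ψ) (GsqY i (parSymY i) D U Ψ)
      ≤ (8 * ((((ℓ + 1) ^ i.k : ℕ) : ℝ)) ^ 2) ^ 2 * trIP (fun _ => (1 : ℝ)) Ψ Ψ := by
  have h := trIP_ringInverse_self_le (fun _ => one_pos) (coerciveConst_pos i)
    (fun Φ => trIP_padDeltaY_parSymY_ge i hG hC0 hC1 hreg D Φ) (cubeProjY i D Ψ)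
  have hP1 : trIP (fun _ => (1 : ℝ)) (GsqY i (parSymY i) D U Ψ) (GsqY i (parSymY i) D U Ψ)
      ≤ trIP (fun _ => (1 : ℝ)) (Ring.inverse (padDeltaY i (parSymY i) D U) (cubeProjY i D Ψ))
          (Ring.inverse (padDeltaY i (parSymY i) D U) (cubeProjY i D Ψ)) := by
    rw [GsqY_apply]
    exact trIP_cubeProjY_self_le i D _
  have hP2 := trIP_cubeProjY_self_le i D Ψ
  have h' : ((1 / 8 : ℝ) * (((((ℓ + 1) ^ i.k : ℕ) : ℝ)) ^ 2)⁻¹) ^ 2 * trIP (fun _ => (1 : ℝ)) (GsqY i (parSymY i) D U Ψ) (GsqY i (parSymY i) D U Ψ)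
      ≤ trIP (fun _ => (1 : ℝ)) Ψ Ψ :=
    le_trans (mul_le_mul_of_nonneg_left hP1 (sq_nonneg _)) (h.trans hP2)
  have e : ((1 / 8 : ℝ) * (((((ℓ + 1) ^ i.k : ℕ) : ℝ)) ^ 2)⁻¹) ^ 2 * ((8 * ((((ℓ + 1) ^ i.k : ℕ) : ℝ)) ^ 2) ^ 2) = 1 := by
    field_simp
  calc trIP (fun _ => (1 : ℝ)) (GsqY i (parSymY i) D U Ψ) (GsqY i (parSymY i) D U Ψ)
      = ((8 * ((((ℓ + 1) ^ i.k : ℕ) : ℝ)) ^ 2) ^ 2) *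
          (((1 / 8 : ℝ) * (((((ℓ + 1) ^ i.k : ℕ) : ℝ)) ^ 2)⁻¹) ^ 2 *
            trIP (fun _ => (1 : ℝ)) (GsqY i (parSymY i) D U Ψ) (GsqY i (parSymY i) D U Ψ)) := by
        rw [← mul_assoc, mul_comm ((8 * _) ^ 2), e, one_mul]
    _ ≤ (8 * ((((ℓ + 1) ^ i.k : ℕ) : ℝ)) ^ 2) ^ 2 * trIP (fun _ => (1 : ℝ)) Ψ Ψ := mul_le_mul_of_nonneg_left h' (by positivity)

/-- ★★ **«G′_□(U) ≤ 8L^{2k}» AS A FORM ON THE CLASS, UNIFORMLY IN □**: `⟨Ψ, G′_□(U)Ψ⟩₁ ≤ 8·(L^k)²·‖Ψ‖²₁`. [cite: Balaban1985BackgroundPropagators, Thm 3.1 p.397, Cor 3.6 p.408, (3.79) p.406] -/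
theorem trIP_GsqY_parSymY_le [Nonempty (Fin N)] (hG : G ≤ B7Prop2Explicit.unitaryUnits (Matrix (Fin N) (Fin N) ℂ))
    {U : CfgY (Matrix (Fin N) (Fin N) ℂ) i} {c α₀ : ℝ} (hC0 : 0 ≤ c * (kGeo i).M * α₀) (hC1 : c * (kGeo i).M * α₀ * ((d : ℝ) + 1) ≤ 1 / 16)
    (hreg : (bg9K (Matrix (Fin N) (Fin N) ℂ) G i).Reg335 c α₀ U) (D : Finset (SiteY i)) (Ψ : SiteY i → Matrix (Fin N) (Fin N) ℂ) :
    trIP (fun _ => (1 : ℝ)) Ψ (GsqY i (parSymY i) D U Ψ) ≤ 8 * ((((ℓ + 1) ^ i.k : ℕ) : ℝ)) ^ 2 * trIP (fun _ => (1 : ℝ)) Ψ Ψ := by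
  have h := trIP_ringInverse_le (fun _ => one_pos) (coerciveConst_pos i)
    (fun Φ => trIP_padDeltaY_parSymY_ge i hG hC0 hC1 hreg D Φ) (cubeProjY i D Ψ)
  have hP2 := trIP_cubeProjY_self_le i D Ψ
  rw [trIP_GsqY_right i _ (parSymY i) D U Ψ Ψ]
  have h' : (1 / 8 : ℝ) * (((((ℓ + 1) ^ i.k : ℕ) : ℝ)) ^ 2)⁻¹ *
      trIP (fun _ => (1 : ℝ)) (cubeProjY i D Ψ) (Ring.inverse (padDeltaY i (parSymY i) D U) (cubeProjY i D Ψ)) ≤ trIP (fun _ => (1 : ℝ)) Ψ Ψ :=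
    h.trans hP2
  have e : (1 / 8 : ℝ) * (((((ℓ + 1) ^ i.k : ℕ) : ℝ)) ^ 2)⁻¹ * (8 * ((((ℓ + 1) ^ i.k : ℕ) : ℝ)) ^ 2) = 1 := by field_simp
  calc trIP (fun _ => (1 : ℝ)) (cubeProjY i D Ψ) (Ring.inverse (padDeltaY i (parSymY i) D U) (cubeProjY i D Ψ))
      = (8 * ((((ℓ + 1) ^ i.k : ℕ) : ℝ)) ^ 2) * ((1 / 8 : ℝ) * (((((ℓ + 1) ^ i.k : ℕ) : ℝ)) ^ 2)⁻¹ *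
          trIP (fun _ => (1 : ℝ)) (cubeProjY i D Ψ) (Ring.inverse (padDeltaY i (parSymY i) D U) (cubeProjY i D Ψ))) := by
        rw [← mul_assoc, mul_comm (8 * _), e, one_mul]
    _ ≤ 8 * ((((ℓ + 1) ^ i.k : ℕ) : ℝ)) ^ 2 * trIP (fun _ => (1 : ℝ)) Ψ Ψ := mul_le_mul_of_nonneg_left h' (by positivity)

/-- ★★ **THE COERCIVITY TRANSPORTED TO `G′_□(U)`**: `(1∕8)·(L^k)⁻²·‖G′_□(U)Ψ‖²₁ ≤ ⟨Ψ, G′_□(U)Ψ⟩₁` on the class, every □ (in particular `G′_□(U)` is a positive form).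
[cite: Balaban1985BackgroundPropagators, Thm 3.1 p.397, Cor 3.6 p.408, (3.25) p.395 («positivity of the operators G′»), (3.79) p.406] -/
theorem trIP_GsqY_parSymY_ge_self [Nonempty (Fin N)] (hG : G ≤ B7Prop2Explicit.unitaryUnits (Matrix (Fin N) (Fin N) ℂ))
    {U : CfgY (Matrix (Fin N) (Fin N) ℂ) i} {c α₀ : ℝ} (hC0 : 0 ≤ c * (kGeo i).M * α₀) (hC1 : c * (kGeo i).M * α₀ * ((d : ℝ) + 1) ≤ 1 / 16)
    (hreg : (bg9K (Matrix (Fin N) (Fin N) ℂ) G i).Reg335 c α₀ U) (D : Finset (SiteY i)) (Ψ : SiteY i → Matrix (Fin N) (Fin N) ℂ) :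
    (1 / 8 : ℝ) * (((((ℓ + 1) ^ i.k : ℕ) : ℝ)) ^ 2)⁻¹ * trIP (fun _ => (1 : ℝ)) (GsqY i (parSymY i) D U Ψ) (GsqY i (parSymY i) D U Ψ)
      ≤ trIP (fun _ => (1 : ℝ)) Ψ (GsqY i (parSymY i) D U Ψ) := by
  have h := trIP_ringInverse_ge_self (fun _ => one_pos) (coerciveConst_pos i)
    (fun Φ => trIP_padDeltaY_parSymY_ge i hG hC0 hC1 hreg D Φ) (cubeProjY i D Ψ)
  have hP1 : trIP (fun _ => (1 : ℝ)) (GsqY i (parSymY i) D U Ψ) (GsqY i (parSymY i) D U Ψ)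
      ≤ trIP (fun _ => (1 : ℝ)) (Ring.inverse (padDeltaY i (parSymY i) D U) (cubeProjY i D Ψ))
          (Ring.inverse (padDeltaY i (parSymY i) D U) (cubeProjY i D Ψ)) := by
    rw [GsqY_apply]
    exact trIP_cubeProjY_self_le i D _
  rw [trIP_GsqY_right i _ (parSymY i) D U Ψ Ψ]
  refine le_trans ?_ h
  exact mul_le_mul_of_nonneg_left hP1 (le_of_lt (coerciveConst_pos i))

/-- ★ **THE LEVEL-WEIGHTED COERCIVITY TRANSPORTED TO `G′_□(U)`**: `(1∕8)·Σ_z (L^{lev z})⁻²·HS((G′_□(U)Ψ)(z)) ≤ ⟨Ψ, G′_□(U)Ψ⟩₁` on the class, every □.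
[cite: Balaban1985BackgroundPropagators, Thm 3.1 p.397, Cor 3.6 p.408, (3.24) p.394, (3.79) p.406; Balaban1984PropagatorsII, (2.14) p.225] -/
theorem levelMass_GsqY_parSymY_le [Nonempty (Fin N)] (hG : G ≤ B7Prop2Explicit.unitaryUnits (Matrix (Fin N) (Fin N) ℂ))
    {U : CfgY (Matrix (Fin N) (Fin N) ℂ) i} {c α₀ : ℝ} (hC0 : 0 ≤ c * (kGeo i).M * α₀) (hC1 : c * (kGeo i).M * α₀ * ((d : ℝ) + 1) ≤ 1 / 16)
    (hreg : (bg9K (Matrix (Fin N) (Fin N) ℂ) G i).Reg335 c α₀ U) (D : Finset (SiteY i)) (Ψ : SiteY i → Matrix (Fin N) (Fin N) ℂ) :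
    (1 / 8 : ℝ) * ∑ z : SiteY i, (((((ℓ + 1) ^ (blkOf i.D.toDomains z).1.1 : ℕ) : ℝ)) ^ 2)⁻¹ * ∑ a, ∑ b, ‖GsqY i (parSymY i) D U Ψ z a b‖ ^ 2
      ≤ trIP (fun _ => (1 : ℝ)) Ψ (GsqY i (parSymY i) D U Ψ) := by
  have hunit : IsUnit (padDeltaY i (parSymY i) D U) := isUnit_padDeltaY_parSymY i hG hreg.1 D
  have h := trIP_padDeltaY_parSymY_ge_levelMass i hG hC0 hC1 hreg D (Ring.inverse (padDeltaY i (parSymY i) D U) (cubeProjY i D Ψ))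
  rw [apply_inverse_of_isUnit hunit, trIP_cubeProjY_symm, trIP_comm, ← GsqY_apply i (parSymY i) D U Ψ] at h
  refine le_trans ?_ h
  refine mul_le_mul_of_nonneg_left (Finset.sum_le_sum fun z _ => mul_le_mul_of_nonneg_left ?_ (inv_nonneg.2 (by positivity))) (by norm_num)
  rw [GsqY_apply, hs_cubeProjY_apply]
  split_ifs
  · exact le_rfl
  · exact hs_nonneg _

end Main

end Literature.MathematicalPhysics.QuantumFieldTheory.Balaban1983to89.B9Thm31SiteGsqBoundsReg335Y
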